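import Summits.AtomisticToContinuum.Crystallization.Theses.HolmgrenBoyleLind
import Literature.Probability.Process.PointStationaryLaw

/-!
# Crux `HolmgrenBoyleLind.GroundStatesChargeFLCEquilibrium` (stmt-AtomisticToContinuum-6076):
# tightness of the content stub — neither the energy nor the stationarity hypothesis can be dropped

The registered content stub `stub_minimisingLawsChargeFLC` of the line `registered` says: every
probability law `P` on rooted configurations of `ℝ³` which is (H3) a.s. a rooted `δ`-hard-core
counting measure, (H4) point-stationary (Mecke / mass-transport identity) and (H5) minimising
(`E_P[h] = ∫ (∫ V_LJ ‖y‖ dμ(y)) / 2 dP ≤ e* = ⨅_Q e(Q)`) charges, at every scale `(R, ε)` and at one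
base point, the `ε`-fattened patches of ONE Delone set of finite local complexity.

This file records, kernel-checked, the two `_false_without_` facts that delimit the stub (the
products a disprover would file; none was filed on this crux):

* `patchEvent_measure_zero_of_ae_bounded` — a law almost surely carried by configurations with
  no atom outside a fixed ball `B̄(0, M)` charges NO `r`-dense set: at radius `R = M + 1 + 2r`
  and tolerance `ε = 1/2` the two-way matching event is `P`-null (an `r`-dense `Λ` has a point at
  distance `∈ [M + 1, M + 1 + 2r]` from the base point, whose matched atom would lie outside the
  ball).
* `stub_minimisingLawsChargeFLC_false_without_energy` — dropping (H5): the single-atom law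
  `δ_{δ_0}` (the configuration consisting of the root alone) is a probability law, a.s. rooted
  `δ`-hard-core for every `δ` and point-stationary
  (`Literature.Probability.Process.isPointStationaryLaw_dirac_dirac_zero`), yet by the previous
  lemma (`M = 0`) it charges no Delone set. So the energy hypothesis is indispensable (and it does
  exclude this law only because `e* < 0`).
* `stub_minimisingLawsChargeFLC_false_without_stationarity` — dropping (H4): the energy
  hypothesis alone constrains only the ROOT. For `n` with `n ≥ -24 e*` the deterministic rooted
  configuration `S_n = {0} ∪ {p_0, …, p_{n-1}}`, `p_k = (2k/(1+k²), (1−k²)/(1+k²), 0)` distinct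
  points of the unit sphere (`V_LJ(1) = −1/12`, the minimum of the pair potential), has root energy
  `h(S_n)/2 = −n/24 ≤ e*`; the law `δ_{count|S_n}` is a probability law, a.s. rooted hard-core
  (finite sets are separated) and minimising in the sense of (H5), yet bounded, hence (by the
  first lemma with `M = 1`) it charges no Delone set. So point-stationarity is indispensable: it is
  what propagates the energy constraint from the root to every atom.

Helper lemmas: `measurableSet_setOf_eq_count_restrict` (the Giry σ-algebra separates the counting
measure of a finite set: `{μ | μ = count|S}` is cut out by `μ Sᶜ = 0` and `μ {a} = 1`, `a ∈ S`),
`ae_eq_dirac_count_restrict`, `exists_pos_forall_ne_le_dist_of_finite` (a finite subset of a metric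
space is uniformly separated), `setIntegral_count_finset` (`∫_{S} f d count = Σ_S f` for a finset).
All `[folklore]`; helper file for item stmt-AtomisticToContinuum-6076 (`--supports`), nothing here
closes an item, and nothing here bears on the truth of the stub itself (an open problem): the two
theorems only certify that no reshaping of the line may drop (H4) or (H5).
-/

noncomputable section

open MeasureTheory Filter Set
open scoped ENNReal Topology

namespace Summit.AtomisticToContinuum.Crystallization.Theorems.HolmgrenBoyleLindGroundStatesChargeFLCEquilibrium

open Literature.MathematicalPhysics.StatisticalMechanics Literature.Probability.Process

/-! ### Measure-theoretic helpers -/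

/-- The set of configurations equal to the counting measure `count|S` of a FINITE set `S ⊂ ℝ³` is
measurable in the Giry σ-algebra: it is cut out by the evaluation `μ Sᶜ = 0` and the finitely many
evaluations `μ {a} = 1`, `a ∈ S`. [folklore] -/
theorem measurableSet_setOf_eq_count_restrict {S : Set (EuclideanSpace ℝ (Fin 3))} (hS : S.Finite) :
    MeasurableSet {μ : Measure (EuclideanSpace ℝ (Fin 3)) | μ = Measure.count.restrict S} := by
  have hSm : MeasurableSet S := hS.measurableSet
  have hrepr : {μ : Measure (EuclideanSpace ℝ (Fin 3)) | μ = Measure.count.restrict S} =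
      {μ : Measure (EuclideanSpace ℝ (Fin 3)) | μ Sᶜ = 0} ∩ ⋂ a ∈ S, {μ : Measure (EuclideanSpace ℝ (Fin 3)) | μ {a} = 1} := by
    ext μ
    simp only [mem_setOf_eq, mem_inter_iff, mem_iInter]
    constructor
    · rintro rfl
      refine ⟨?_, fun a ha => ?_⟩
      · rw [Measure.restrict_apply hSm.compl]
        simp
      · rw [Measure.restrict_apply (measurableSet_singleton a),
          inter_eq_left.2 (singleton_subset_iff.2 ha), Measure.count_singleton]
    · rintro ⟨hc, h1⟩
      ext s hs
      rw [Measure.restrict_apply hs]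
      have hfin : (s ∩ S).Finite := hS.inter_of_right s
      rw [← measure_inter_add_sdiff s hSm]
      have hdiff : μ (s \ S) = 0 := measure_mono_null (sdiff_subset_compl s S) hc
      rw [hdiff, add_zero]
      have hU : s ∩ S = ⋃ b ∈ hfin.toFinset, {b} := by
        ext
        simp
      have hdisj : (↑hfin.toFinset : Set (EuclideanSpace ℝ (Fin 3))).PairwiseDisjoint (fun b : (EuclideanSpace ℝ (Fin 3)) => ({b} : Set (EuclideanSpace ℝ (Fin 3)))) :=
        fun a _ b _ hab => disjoint_singleton.2 hab
      rw [hU, measure_biUnion_finset hdisj (fun b _ => measurableSet_singleton b),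
        measure_biUnion_finset hdisj (fun b _ => measurableSet_singleton b)]
      refine Finset.sum_congr rfl fun b hb => ?_
      rw [Measure.count_singleton]
      exact h1 b (by simpa using hb : b ∈ s ∧ b ∈ S).2
  rw [hrepr]
  refine ((Measure.measurable_coe hSm.compl) (measurableSet_singleton 0)).inter ?_
  exact MeasurableSet.biInter hS.countable fun a _ =>
    (Measure.measurable_coe (measurableSet_singleton a)) (measurableSet_singleton 1)

/-- Under the deterministic law `δ_{count|S}` (`S` finite) almost every configuration IS
`count|S`. [folklore] -/
theorem ae_eq_dirac_count_restrict {S : Set (EuclideanSpace ℝ (Fin 3))} (hS : S.Finite) :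
    ∀ᵐ μ ∂(Measure.dirac (Measure.count.restrict S) : Measure (Measure (EuclideanSpace ℝ (Fin 3)))),
      μ = Measure.count.restrict S := by
  rw [ae_iff]
  have h : {μ : Measure (EuclideanSpace ℝ (Fin 3)) | ¬μ = Measure.count.restrict S} =
      {μ : Measure (EuclideanSpace ℝ (Fin 3)) | μ = Measure.count.restrict S}ᶜ := rfl
  rw [h, Measure.dirac_apply' _ (measurableSet_setOf_eq_count_restrict hS).compl]
  simp

/-- A finite subset of a metric space is uniformly separated: some `δ > 0` bounds the distance of
any two distinct points from below. [folklore] -/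
theorem exists_pos_forall_ne_le_dist_of_finite {X : Type*} [MetricSpace X] {S : Set X}
    (hS : S.Finite) : ∃ δ : ℝ, 0 < δ ∧ ∀ x ∈ S, ∀ y ∈ S, x ≠ y → δ ≤ dist x y := by
  classical
  set D : Finset ℝ := ((hS.toFinset ×ˢ hS.toFinset).filter (fun xy => xy.1 ≠ xy.2)).image
    (fun xy => dist xy.1 xy.2) with hD
  have hmem : ∀ x ∈ S, ∀ y ∈ S, x ≠ y → dist x y ∈ D := by
    intro x hx y hy hxy
    rw [hD, Finset.mem_image]
    exact ⟨(x, y), Finset.mem_filter.2 ⟨Finset.mem_product.2 ⟨hS.mem_toFinset.2 hx,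
      hS.mem_toFinset.2 hy⟩, hxy⟩, rfl⟩
  by_cases hne : D.Nonempty
  · refine ⟨D.min' hne, ?_, fun x hx y hy hxy => D.min'_le _ (hmem x hx y hy hxy)⟩
    obtain ⟨xy, hxy, hval⟩ := Finset.mem_image.1 (D.min'_mem hne)
    rw [← hval]
    exact dist_pos.2 (Finset.mem_filter.1 hxy).2
  · refine ⟨1, one_pos, fun x hx y hy hxy => ?_⟩
    exact absurd ⟨_, hmem x hx y hy hxy⟩ hne

/-- The integral of a real function against the counting measure of a finset is the finite sum.
[folklore] -/
theorem setIntegral_count_finset (s : Finset (EuclideanSpace ℝ (Fin 3))) (f : (EuclideanSpace ℝ (Fin 3)) → ℝ) :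
    ∫ x in (↑s : Set (EuclideanSpace ℝ (Fin 3))), f x ∂Measure.count = ∑ x ∈ s, f x := by
  rw [setIntegral_finset]
  · simp
  · rw [← (s : Set (EuclideanSpace ℝ (Fin 3))).biUnion_of_singleton, integrableOn_finite_biUnion s.finite_toSet]
    intro i _
    exact integrableOn_singleton (hx := by rw [Measure.count_singleton]; exact ENNReal.one_lt_top)

/-! ### Bounded laws charge no Delone set -/

/-- **A law almost surely carried by bounded configurations charges no `r`-dense set.** If
`P`-almost every configuration `ν` has no atom outside the closed ball `B̄(0, M)` (`M ≥ 0`), then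
for every `r`-dense set `Λ` (`r > 0`) and every base point `q₀` the two-way matching event of the
crux at radius `R = M + 1 + 2r` and tolerance `ε = 1/2` is `P`-null: `r`-density gives a point
`s ∈ Λ` with `M + 1 ≤ dist s q₀ ≤ M + 1 + 2r`, and an atom `p` of `ν` within `1/2` of `A (s - q₀)`
would have `‖p‖ ≥ M + 1/2 > M`. [folklore] -/
theorem patchEvent_measure_zero_of_ae_bounded {P : Measure (Measure (EuclideanSpace ℝ (Fin 3)))} {M : ℝ} (hM : 0 ≤ M)
    (hP : ∀ᵐ ν ∂P, ν (Metric.closedBall (0 : (EuclideanSpace ℝ (Fin 3))) M)ᶜ = 0)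
    {Λ : Set (EuclideanSpace ℝ (Fin 3))} {r : ℝ} (hr : 0 < r) (hden : ∀ c : (EuclideanSpace ℝ (Fin 3)), ∃ y ∈ Λ, dist y c ≤ r) (q₀ : (EuclideanSpace ℝ (Fin 3))) :
    ∃ R ε : ℝ, 0 < R ∧ 0 < ε ∧
      P {ν : Measure (EuclideanSpace ℝ (Fin 3)) | ∃ A : (EuclideanSpace ℝ (Fin 3)) →ₗᵢ[ℝ] (EuclideanSpace ℝ (Fin 3)),
        (∀ s ∈ Λ, dist s q₀ ≤ R → ∃ p : (EuclideanSpace ℝ (Fin 3)), ν {p} ≠ 0 ∧ dist p (A (s - q₀)) ≤ ε) ∧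
        (∀ p : (EuclideanSpace ℝ (Fin 3)), ν {p} ≠ 0 → ‖p‖ ≤ R → ∃ s ∈ Λ, dist p (A (s - q₀)) ≤ ε)} = 0 := by
  -- a point of `Λ` at distance `∈ [M + 1, M + 1 + 2r]` from `q₀`
  set e : (EuclideanSpace ℝ (Fin 3)) := EuclideanSpace.single (0 : Fin 3) (M + 1 + r) with he
  have henorm : ‖e‖ = M + 1 + r := by
    rw [he, PiLp.norm_single, Real.norm_eq_abs, abs_of_nonneg (by linarith)]
  obtain ⟨s, hsΛ, hsc⟩ := hden (q₀ + e)
  have hdc : dist (q₀ + e) q₀ = M + 1 + r := by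
    rw [dist_eq_norm, add_sub_cancel_left, henorm]
  have hs_lo : M + 1 ≤ dist s q₀ := by
    have := dist_triangle (q₀ + e) s q₀
    rw [dist_comm (q₀ + e) s] at this
    linarith
  have hs_hi : dist s q₀ ≤ M + 1 + 2 * r := by
    have := dist_triangle s (q₀ + e) q₀
    linarith
  refine ⟨M + 1 + 2 * r, 1 / 2, by linarith, by norm_num, ?_⟩
  -- the event is contained in the `P`-null set `{ν | ν (B̄(0,M))ᶜ ≠ 0}`
  refine measure_mono_null (t := {ν : Measure (EuclideanSpace ℝ (Fin 3)) | ν (Metric.closedBall (0 : (EuclideanSpace ℝ (Fin 3))) M)ᶜ ≠ 0}) ?_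
    (by simpa only [ae_iff, not_not] using hP)
  rintro ν ⟨A, h1, -⟩
  obtain ⟨p, hp, hpd⟩ := h1 s hsΛ hs_hi
  have hAs : ‖A (s - q₀)‖ = dist s q₀ := by
    rw [LinearIsometry.norm_map, dist_eq_norm]
  have hp_norm : M < ‖p‖ := by
    have h2 : ‖A (s - q₀)‖ ≤ ‖p‖ + dist p (A (s - q₀)) := by
      have := norm_le_norm_add_norm_sub' (A (s - q₀)) p
      rw [← dist_eq_norm, dist_comm] at this
      linarith [norm_sub_rev p (A (s - q₀)), dist_eq_norm p (A (s - q₀))]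
    linarith
  have hp_out : p ∈ (Metric.closedBall (0 : (EuclideanSpace ℝ (Fin 3))) M)ᶜ := by
    rw [mem_compl_iff, Metric.mem_closedBall, dist_zero_right, not_le]
    exact hp_norm
  intro h0
  exact hp (measure_mono_null (singleton_subset_iff.2 hp_out) h0)

/-! ### The energy hypothesis cannot be dropped -/

/-- **Stub 1 without the energy hypothesis is FALSE.** The statement obtained from the registered
stub `stub_minimisingLawsChargeFLC` by deleting the minimisation hypothesis
`E_P[h] ≤ ⨅_Q e(Q)` fails: the single-atom law `δ_{δ_0}` (probability, a.s. the rooted `δ`-hard-core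
configuration `{0}` for every `δ`, point-stationary by
`Literature.Probability.Process.isPointStationaryLaw_dirac_dirac_zero`) charges no `r`-dense set
(`patchEvent_measure_zero_of_ae_bounded` with `M = 0`). Hence any proof of the stub must use the
energy hypothesis (which excludes this law exactly because `e* < 0`). [folklore] -/
theorem stub_minimisingLawsChargeFLC_false_without_energy :
    ¬ (∀ δ : ℝ, 0 < δ → ∀ P : Measure (Measure (EuclideanSpace ℝ (Fin 3))), IsProbabilityMeasure P →
      (∀ᵐ μ ∂P, (∃ S : Set (EuclideanSpace ℝ (Fin 3)), (0 : EuclideanSpace ℝ (Fin 3)) ∈ S ∧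
        (∀ x ∈ S, ∀ y ∈ S, x ≠ y → δ ≤ dist x y) ∧
        μ = (Measure.count : Measure (EuclideanSpace ℝ (Fin 3))).restrict S)) →
      (∀ g : Measure (EuclideanSpace ℝ (Fin 3)) → EuclideanSpace ℝ (Fin 3) → ENNReal,
        Measurable (Function.uncurry g) →
        ∫⁻ μ, ∫⁻ y, g μ y ∂μ ∂P = ∫⁻ μ, ∫⁻ y, g (Measure.map (fun z => z - y) μ) (-y) ∂μ ∂P) →
      ∃ (Λ : Set (EuclideanSpace ℝ (Fin 3))) (δ' r : ℝ), 0 < δ' ∧ 0 < r ∧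
        (∀ x ∈ Λ, ∀ y ∈ Λ, x ≠ y → δ' ≤ dist x y) ∧
        (∀ c : EuclideanSpace ℝ (Fin 3), ∃ y ∈ Λ, dist y c ≤ r) ∧
        (∀ R : ℝ, Set.Finite {S : Set (EuclideanSpace ℝ (Fin 3)) |
          ∃ x ∈ Λ, S = {v : EuclideanSpace ℝ (Fin 3) | x + v ∈ Λ ∧ ‖v‖ ≤ R}}) ∧
        ∃ q₀ ∈ Λ, ∀ R ε : ℝ, 0 < R → 0 < ε →
          P {ν : Measure (EuclideanSpace ℝ (Fin 3)) |
              ∃ A : EuclideanSpace ℝ (Fin 3) →ₗᵢ[ℝ] EuclideanSpace ℝ (Fin 3),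
                (∀ s ∈ Λ, dist s q₀ ≤ R →
                  ∃ p : EuclideanSpace ℝ (Fin 3), ν {p} ≠ 0 ∧ dist p (A (s - q₀)) ≤ ε) ∧
                (∀ p : EuclideanSpace ℝ (Fin 3), ν {p} ≠ 0 → ‖p‖ ≤ R →
                  ∃ s ∈ Λ, dist p (A (s - q₀)) ≤ ε)} ≠ 0) := by
  intro h
  -- the single-atom law
  set P : Measure (Measure (EuclideanSpace ℝ (Fin 3))) := Measure.dirac (Measure.dirac (0 : (EuclideanSpace ℝ (Fin 3)))) with hPdef
  have hae : ∀ᵐ μ ∂P, μ = Measure.dirac 0 := ae_dirac_dirac_zero (measurableSet_singleton 0)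
  have hcore : ∀ᵐ μ ∂P, (∃ S : Set (EuclideanSpace ℝ (Fin 3)), (0 : (EuclideanSpace ℝ (Fin 3))) ∈ S ∧ (∀ x ∈ S, ∀ y ∈ S, x ≠ y → (1 : ℝ) ≤ dist x y) ∧
      μ = (Measure.count : Measure (EuclideanSpace ℝ (Fin 3))).restrict S) :=
    hae.mono fun μ hμ => by
      subst hμ
      exact isRootedHardCore_dirac_zero 1
  have hstat : ∀ g : Measure (EuclideanSpace ℝ (Fin 3)) → (EuclideanSpace ℝ (Fin 3)) → ENNReal, Measurable (Function.uncurry g) →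
      ∫⁻ μ, ∫⁻ y, g μ y ∂μ ∂P = ∫⁻ μ, ∫⁻ y, g (Measure.map (fun z => z - y) μ) (-y) ∂μ ∂P :=
    isPointStationaryLaw_dirac_dirac_zero
  obtain ⟨Λ, δ', r, -, hr, -, hden, -, q₀, -, hch⟩ := h 1 one_pos P inferInstance hcore hstat
  -- it is carried by configurations inside the ball of radius `0`
  have hP : ∀ᵐ ν ∂P, ν (Metric.closedBall (0 : (EuclideanSpace ℝ (Fin 3))) 0)ᶜ = 0 :=
    hae.mono fun ν hν => by
      subst hν
      rw [Measure.dirac_apply' _ Metric.isClosed_closedBall.measurableSet.compl,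
        indicator_of_notMem]
      exact fun h0 => h0 (Metric.mem_closedBall_self le_rfl)
  obtain ⟨R, ε, hR, hε, h0⟩ := patchEvent_measure_zero_of_ae_bounded le_rfl hP hr hden q₀
  exact hch R ε hR hε h0

/-! ### The point-stationarity hypothesis cannot be dropped -/

/-- **Stub 1 without point-stationarity is FALSE.** The statement obtained from the registered
stub `stub_minimisingLawsChargeFLC` by deleting the Mecke / mass-transport hypothesis fails: the
energy hypothesis `∫ (∫ V_LJ ‖y‖ dμ) / 2 dP ≤ e*` only constrains the root. Choose `n ≥ −24 e*`
and the rooted configuration `S_n = {0} ∪ {p_0, …, p_{n−1}}` with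
`p_k = (2k/(1+k²), (1−k²)/(1+k²), 0)`, `n` distinct points of the unit sphere; `V_LJ(1) = −1/12`
gives root energy `−n/24 ≤ e*`, `S_n` is finite hence `δ`-separated for some `δ > 0`, and the law
`δ_{count|S_n}` is a probability law a.s. equal to `count|S_n`; being carried by configurations
inside `B̄(0, 1)` it charges no `r`-dense set (`patchEvent_measure_zero_of_ae_bounded`, `M = 1`).
Hence any proof of the stub must use point-stationarity (it is what spreads the energy
constraint from the root to all atoms). [folklore] -/
theorem stub_minimisingLawsChargeFLC_false_without_stationarity :
    ¬ (∀ δ : ℝ, 0 < δ → ∀ P : Measure (Measure (EuclideanSpace ℝ (Fin 3))), IsProbabilityMeasure P →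
      (∀ᵐ μ ∂P, (∃ S : Set (EuclideanSpace ℝ (Fin 3)), (0 : EuclideanSpace ℝ (Fin 3)) ∈ S ∧
        (∀ x ∈ S, ∀ y ∈ S, x ≠ y → δ ≤ dist x y) ∧
        μ = (Measure.count : Measure (EuclideanSpace ℝ (Fin 3))).restrict S)) →
      (∫ μ, (∫ y, lennardJones ‖y‖ ∂μ) / 2 ∂P) ≤
        (⨅ Q : PeriodicConfiguration 3, Q.energyPerParticle lennardJones) →
      ∃ (Λ : Set (EuclideanSpace ℝ (Fin 3))) (δ' r : ℝ), 0 < δ' ∧ 0 < r ∧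
        (∀ x ∈ Λ, ∀ y ∈ Λ, x ≠ y → δ' ≤ dist x y) ∧
        (∀ c : EuclideanSpace ℝ (Fin 3), ∃ y ∈ Λ, dist y c ≤ r) ∧
        (∀ R : ℝ, Set.Finite {S : Set (EuclideanSpace ℝ (Fin 3)) |
          ∃ x ∈ Λ, S = {v : EuclideanSpace ℝ (Fin 3) | x + v ∈ Λ ∧ ‖v‖ ≤ R}}) ∧
        ∃ q₀ ∈ Λ, ∀ R ε : ℝ, 0 < R → 0 < ε →
          P {ν : Measure (EuclideanSpace ℝ (Fin 3)) |
              ∃ A : EuclideanSpace ℝ (Fin 3) →ₗᵢ[ℝ] EuclideanSpace ℝ (Fin 3),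
                (∀ s ∈ Λ, dist s q₀ ≤ R →
                  ∃ p : EuclideanSpace ℝ (Fin 3), ν {p} ≠ 0 ∧ dist p (A (s - q₀)) ≤ ε) ∧
                (∀ p : EuclideanSpace ℝ (Fin 3), ν {p} ≠ 0 → ‖p‖ ≤ R →
                  ∃ s ∈ Λ, dist p (A (s - q₀)) ≤ ε)} ≠ 0) := by
  intro h
  set estar : ℝ := ⨅ Q : PeriodicConfiguration 3, Q.energyPerParticle lennardJones with hestar
  -- the number of unit-distance neighbours of the root
  obtain ⟨n, hn⟩ := exists_nat_ge (-24 * estar)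
  -- `n` distinct points of the unit sphere (rational parametrisation of the unit circle)
  set p : ℕ → (EuclideanSpace ℝ (Fin 3)) := fun k => EuclideanSpace.single (0 : Fin 3) (2 * (k : ℝ) / (1 + (k : ℝ) ^ 2)) +
    EuclideanSpace.single (1 : Fin 3) ((1 - (k : ℝ) ^ 2) / (1 + (k : ℝ) ^ 2)) with hp
  have hnorm : ∀ k : ℕ, ‖p k‖ = 1 := by
    intro k
    have h1 : (0 : ℝ) < 1 + (k : ℝ) ^ 2 := by positivity
    have key : (2 * (k : ℝ) / (1 + (k : ℝ) ^ 2)) ^ 2 + ((1 - (k : ℝ) ^ 2) / (1 + (k : ℝ) ^ 2)) ^ 2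
        = 1 := by
      field_simp
      ring
    rw [EuclideanSpace.norm_eq, Real.sqrt_eq_one]
    have h20 : (2 : Fin 3) ≠ 0 := by decide
    have h21 : (2 : Fin 3) ≠ 1 := by decide
    simp only [hp, Fin.sum_univ_three, PiLp.add_apply, PiLp.single_apply, Real.norm_eq_abs, sq_abs]
    simp only [Fin.isValue, ↓reduceIte, add_zero, zero_add, Fin.zero_eq_one_iff,
      OfNat.ofNat_ne_one, one_ne_zero, h20, h21]
    linear_combination key
  have hp1 : ∀ k : ℕ, p k 1 = (1 - (k : ℝ) ^ 2) / (1 + (k : ℝ) ^ 2) := by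
    intro k
    simp [hp]
  have hinj : Function.Injective p := by
    intro m m' hmm'
    have h1 := congrArg (fun v : (EuclideanSpace ℝ (Fin 3)) => v 1) hmm'
    simp only [hp1] at h1
    have hm : (0 : ℝ) < 1 + (m : ℝ) ^ 2 := by positivity
    have hm' : (0 : ℝ) < 1 + (m' : ℝ) ^ 2 := by positivity
    rw [div_eq_div_iff hm.ne' hm'.ne'] at h1
    have h2 : ((m : ℝ)) ^ 2 = ((m' : ℝ)) ^ 2 := by nlinarith
    exact_mod_cast (sq_eq_sq₀ (Nat.cast_nonneg m) (Nat.cast_nonneg m')).1 h2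
  have hp0 : ∀ k : ℕ, p k ≠ 0 := fun k hk => by simpa [hk] using hnorm k
  -- the configuration `S_n = {0} ∪ {p_0, …, p_{n-1}}`
  classical
  set T : Finset (EuclideanSpace ℝ (Fin 3)) := insert 0 ((Finset.range n).image p) with hT
  have h0T : (0 : (EuclideanSpace ℝ (Fin 3))) ∉ (Finset.range n).image p := by
    rw [Finset.mem_image]
    rintro ⟨k, -, hk⟩
    exact hp0 k hk
  set S : Set (EuclideanSpace ℝ (Fin 3)) := ↑T with hS
  have hSfin : S.Finite := T.finite_toSet
  have h0S : (0 : (EuclideanSpace ℝ (Fin 3))) ∈ S := by simp [hS, hT]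
  have hSball : S ⊆ Metric.closedBall (0 : (EuclideanSpace ℝ (Fin 3))) 1 := by
    intro x hx
    rw [hS, Finset.mem_coe, hT, Finset.mem_insert, Finset.mem_image] at hx
    rw [Metric.mem_closedBall, dist_zero_right]
    rcases hx with rfl | ⟨k, -, rfl⟩
    · simp
    · exact (hnorm k).le
  obtain ⟨δ, hδ, hsep⟩ := exists_pos_forall_ne_le_dist_of_finite hSfin
  -- the deterministic law `δ_{count|S_n}`
  set μ₀ : Measure (EuclideanSpace ℝ (Fin 3)) := (Measure.count : Measure (EuclideanSpace ℝ (Fin 3))).restrict S with hμ₀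
  set P : Measure (Measure (EuclideanSpace ℝ (Fin 3))) := Measure.dirac μ₀ with hPdef
  have hae : ∀ᵐ μ ∂P, μ = μ₀ := ae_eq_dirac_count_restrict hSfin
  have hcore : ∀ᵐ μ ∂P, (∃ S' : Set (EuclideanSpace ℝ (Fin 3)), (0 : (EuclideanSpace ℝ (Fin 3))) ∈ S' ∧ (∀ x ∈ S', ∀ y ∈ S', x ≠ y → δ ≤ dist x y) ∧
      μ = (Measure.count : Measure (EuclideanSpace ℝ (Fin 3))).restrict S') :=
    hae.mono fun μ hμ => ⟨S, h0S, hsep, hμ⟩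
  -- root energy of `S_n`: `(0 + n · V(1)) / 2 = -n/24 ≤ e*`
  have hroot : ∫ y, lennardJones ‖y‖ ∂μ₀ = -(n : ℝ) / 12 := by
    rw [hμ₀, hS, setIntegral_count_finset, hT, Finset.sum_insert h0T,
      Finset.sum_image fun a _ b _ hab => hinj hab]
    simp only [norm_zero, lennardJones_zero, hnorm, lennardJones_one, Finset.sum_const,
      Finset.card_range, nsmul_eq_mul, zero_add]
    ring
  have hE : (∫ μ, (∫ y, lennardJones ‖y‖ ∂μ) / 2 ∂P) ≤ estar := by
    have hcongr : (fun μ : Measure (EuclideanSpace ℝ (Fin 3)) => (∫ y, lennardJones ‖y‖ ∂μ) / 2) =ᵐ[P]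
        fun _ => (∫ y, lennardJones ‖y‖ ∂μ₀) / 2 :=
      hae.mono fun μ hμ => by simp only [hμ]
    rw [integral_congr_ae hcongr, integral_const, hroot]
    simp only [probReal_univ, smul_eq_mul, one_mul]
    linarith
  obtain ⟨Λ, δ', r, -, hr, -, hden, -, q₀, -, hch⟩ := h δ hδ P inferInstance hcore hE
  -- the law is carried by configurations inside the closed unit ball
  have hP : ∀ᵐ ν ∂P, ν (Metric.closedBall (0 : (EuclideanSpace ℝ (Fin 3))) 1)ᶜ = 0 :=
    hae.mono fun ν hν => by
      rw [hν, hμ₀, Measure.restrict_apply Metric.isClosed_closedBall.measurableSet.compl]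
      have : (Metric.closedBall (0 : (EuclideanSpace ℝ (Fin 3))) 1)ᶜ ∩ S = ∅ :=
        eq_empty_of_forall_notMem fun x ⟨hx1, hx2⟩ => hx1 (hSball hx2)
      rw [this, measure_empty]
  obtain ⟨R, ε, hR, hε, h0⟩ := patchEvent_measure_zero_of_ae_bounded zero_le_one hP hr hden q₀
  exact hch R ε hR hε h0

end Summit.AtomisticToContinuum.Crystallization.Theorems.HolmgrenBoyleLindGroundStatesChargeFLCEquilibrium

end
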